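import Literature.NumberTheory.EllipticCurves.SkinnerUrban2014.PAdicUnitPeriodRatioAnyPrimeProofs
import Literature.NumberTheory.EllipticCurves.ManinConstantAbbesUllmoDegreeRouteProofs
import Literature.NumberTheory.EllipticCurves.Rank1Residual.GVParityTwistTransportProofs
import Literature.NumberTheory.EllipticCurves.LFunctionPrimeCoeff
import HarnessLib

/-!
# The period unit at `p = 2` (`realPeriodRat_eq_unit_mul_plusPeriod_two`) is EXACTLY the parity of
# the Manin constant of the strong Weil curve along `E[2]`-irreducible classes of odd conductor
# (proofs only)

Topic `NumberTheory/EllipticCurves`; namespace `Literature.NumberTheory.EllipticCurves`. A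
proofs-only companion (theorems only: no definition, no named fact, nothing restated; D-0014 /
D-0026) of the named fact `realPeriodRat_eq_unit_mul_plusPeriod_two` of
`ModularCurvePeriodRatio.lean` — for a globally minimal elliptic `W/ℚ` with good reduction at `2`
and `E[2]` irreducible, and its newform `f`: `Ω(W) = u · Ω⁺_f` with `u ∈ ℚ`, `‖u‖₂ = 1` — whose
printed sources are Abbes–Ullmo 1996 Thm. A (the Manin constant at a prime `p ∤ N`),
Greenberg–Vatsal 2000 §3 Rem. 3.4 (Néron periods along an isogeny class without `p`-isogenies) and
Edixhoven 1991 Prop. 2 / §1 (`Λ(ω_{E₀}) = c₀ Λ_f`).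

HONESTY. Nothing here proves the fact, and no summit statement (in particular not
`BirchSwinnertonDyer`) is proved or advanced by this file. The tree already proves the fact MODULO
Abbes–Ullmo's Thm. A by name (`SkinnerUrban2014.realPeriodRat_eq_unit_mul_plusPeriod_two_fact_of_abbesUllmo`,
`PAdicUnitPeriodRatioAnyPrimeProofs.lean` §5, where the Greenberg–Vatsal step at `p = 2` and
Edixhoven's `Ω(E₀) = |c₀| · Ω⁺_f` are THEOREMS). This file records, as theorems:

1. **The exact print content of the fact** (`realPeriodRat_eq_unit_mul_plusPeriod_two_iff_maninConstant_odd`):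
   over the tree, `realPeriodRat_eq_unit_mul_plusPeriod_two` is EQUIVALENT to
   (M₂-irr) *for every globally minimal elliptic `W₀/ℚ` with good reduction at `2` and `E₀[2]`
   irreducible, and every lattice-optimal parametrisation datum `D₀` of `W₀` (`Λ_{W₀} = c₀ Λ_f`: `W₀`
   is a minimal model of the strong Weil curve `E_f` and `c₀ = D₀.maninConstant` its Manin constant
   w.r.t. a Néron differential), `c₀` is odd* — i.e. the `E[2]`-irreducible slice, at `p = 2 ∤ N`,
   of Abbes–Ullmo's Thm. A ("`p ∤ N ⇒ p ∤ c_E`", Compositio Math. 103 (1996), p. 269). Direction ⇐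
   is the three-step chain of the fact's docstring (`exists_unit_mul_plusPeriod_of_irreducible_of_optimal`,
   a sharpening of `SkinnerUrban2014.exists_unit_mul_plusPeriod_of_irreducible_anyPrime` whose
   Manin hypothesis is asked only of the strong Weil curve ISOGENOUS to `W`, so that good reduction
   at `2` and the irreducibility of `E[2]` can be transported to it); direction ⇒ evaluates the
   fact at the strong Weil curve itself, where `Ω(W₀) = |c₀| · Ω⁺_f` exactly
   (`ModularParametrizationData.realPeriodRat_eq_abs_mul_plusPeriod_of_latticeEq`), so `u = |c₀|`
   and `‖c₀‖₂ = 1`. Consequently NO proof of the fact can avoid the Manin constant at `2` of the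
   `E[2]`-irreducible strong Weil curves of odd conductor: the fact is not weaker than that.
2. **The two printed roads to (M₂-irr), as reductions with displayed hypotheses.**
   (a) Abbes–Ullmo's own proof (op. cit. §3, pp. 276–279: Ribet's `deg φ ∣ r` = Lemme 3.2 (iii),
   and the degree relation of Prop. 3.3–3.4 at `p ∤ N`), through the AU seat's reduction
   (`ManinConstantAbbesUllmoDegreeRouteProofs.lean`), here at `p = 2` only
   (`realPeriodRat_eq_unit_mul_plusPeriod_two_of_ribet_of_degreeRelation_two`).
   (b) The Mazur–Raynaud road (op. cit. Prop. 3.1, pp. 274–275, with Raynaud's appendix,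
   Cor. A.3 (ii) / Cor. A.4, p. 285): for a strong Weil curve `E` with `4 ∤ N`, the sequence of
   Néron models over `ℤ₂` of `0 → A → J₀(N) → E → 0` gives `0 → Lie A → Lie J₀(N) → 2^r Lie E → 0`
   with `r ∈ {0, 1}` (Thm. A.1, `e = 1 = p - 1`), and `r = 0 ⇒ v₂(c_E) = 0` by the `q`-expansion
   principle on `M₀(N)_{𝔽₂}`; `r = 0` holds whenever `E[2]` is RAMIFIED at `2` (Cor. A.4), in
   particular whenever `E` is supersingular at `2` (`E^μ = 0`, Cor. A.3 (ii)) — Raynaud's letter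
   thus proves `2 ∤ c_E` for strong Weil curves with good SUPERSINGULAR reduction at `2`
   (p. 270: "Raynaud a prouvé la conjecture de Manin pour les courbes elliptiques semi-stables sauf
   peut-être … (i) `E` … à réduction ordinaire en `2` telle que `E[2]` soit produit d'un groupe étale
   par un groupe de type multiplicatif …"). On the habitat of the fact's consumers (good
   supersingular reduction at `2`, where `E[2]` is automatically irreducible) this is a SECOND
   print floor, displayed as the hypothesis of
   `exists_unit_mul_plusPeriod_two_of_goodSupersingular_of_maninConstant_odd` (supersingularity at a
   good prime is `2 ∣ a₂`, transported along the class by `a_p(W) = a_p(f) = a_p(W₀)`), and on that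
   habitat the period-unit statement is again EQUIVALENT to the parity statement
   (`exists_unit_mul_plusPeriod_two_of_goodSupersingular_iff_maninConstant_odd`).
   Neither road is formalised: both need Néron models of `E` and `J₀(N)` over `ℤ_(2)`, the smooth
   model `M₀(N)_{ℤ_(2)}` with its `q`-expansion principle, and (b) Tate's theorem on `p`-divisible
   groups — none of which the tree has (its `ModularParametrizationData` is an analytic hypothesis
   structure).
3. **What computation settles**: the fact for newforms of level `N ≤ 130000`, from Cremona's
   verification `c = 1` (Agashe–Ribet–Stein 2006 Thm. 2.6, a named fact of the tree)
   (`exists_unit_mul_plusPeriod_two_of_level_le_of_cremona`); a finite range, not the fact.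

## References

* A. Abbes, E. Ullmo, *À propos de la conjecture de Manin pour les courbes elliptiques
  modulaires*, Compositio Math. 103 (1996) 269–286: Thm. A (p. 269), p. 270, Prop. 3.1
  (pp. 274–275), Lemme 3.2 (iii), Prop. 3.3, Prop. 3.4, Preuve du Thm. A (pp. 276–279); Appendice
  (d'après M. Raynaud) Thm. A.1, Cor. A.3, Cor. A.4 (pp. 279–285). [AbbesUllmo1996]
* R. Greenberg, V. Vatsal, *On the Iwasawa invariants of elliptic curves*, Invent. Math. 142
  (2000), §3, Remark 3.4. [GreenbergVatsal2000]
* B. Edixhoven, *On the Manin constants of modular elliptic curves*, Progr. Math. 89 (1991),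
  Prop. 2 and §1. [EdixhovenManin1991]
* A. Agashe, K. Ribet, W. A. Stein, *The Manin constant*, PAMQ 2 (2006), Thm. 2.5 (= AU Thm. A),
  Thm. 2.6 (Cremona, `N ≤ 130000`). [AgasheRibetStein2006]
* A. Agashe, K. A. Ribet, W. A. Stein, *The modular degree, congruence primes, and multiplicity
  one* (2012), Thm. 2.1. [AgasheRibetStein2012]
* J.-P. Serre, *Propriétés galoisiennes des points d'ordre fini des courbes elliptiques*, Invent.
  Math. 15 (1972), §1.11 (supersingular reduction: inertia acts on `E[p]` through a cyclic group of
  order `p² - 1`, so `E[p]` is ramified). [Serre1972]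
-/

noncomputable section

open scoped MatrixGroups ModularForm

open CongruenceSubgroup Literature.NumberTheory.EllipticCurves.ModularForms

namespace Literature.NumberTheory.EllipticCurves

open _root_.WeierstrassCurve

/-! ### §1. Transport along the isogeny class: good reduction, `a_p`, irreducibility of `E[p]` -/

section Transport

variable {W W₀ : WeierstrassCurve ℚ} [W.IsElliptic] [W₀.IsElliptic] {N : ℕ} [NeZero N]
  {f : CuspForm (Gamma0 N) 2}

/-- A curve whose newform has level prime to `p` has good reduction at `p`: `p ∣ N ↔ p ∣ N_W`
(Atkin–Lehner, `IsNewformOf.dvd_level_iff_dvd_conductorNorm`) and `p ∣ N_W ↔` bad reduction at `p`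
(`dvd_conductorNorm_iff_not_hasGoodReductionAtPrime`). [cite: DiamondShurman2005, §8.3 and Thm. 8.8.1] -/
theorem hasGoodReductionAtPrime_of_isNewformOf_of_not_dvd_level {p : ℕ} [Fact p.Prime]
    (hf₀ : IsNewformOf W₀ f) (hpN : ¬ p ∣ N) : W₀.HasGoodReductionAtPrime p := by
  by_contra h
  exact hpN ((hf₀.dvd_level_iff_dvd_conductorNorm Fact.out).mpr
    ((W₀.dvd_conductorNorm_iff_not_hasGoodReductionAtPrime p).mpr h))

/-- **Good reduction at `p` is shared by two curves with the same newform** (the level is prime to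
`p` as soon as one of them has good reduction at `p`). [cite: DiamondShurman2005, Thm. 8.8.1] -/
theorem hasGoodReductionAtPrime_of_isNewformOf_of_isNewformOf {p : ℕ} [Fact p.Prime]
    (hf : IsNewformOf W f) (hf₀ : IsNewformOf W₀ f) (hgood : W.HasGoodReductionAtPrime p) :
    W₀.HasGoodReductionAtPrime p :=
  hasGoodReductionAtPrime_of_isNewformOf_of_not_dvd_level hf₀
    (SkinnerUrban2014.not_dvd_level_of_hasGoodReductionAtPrime hgood hf)

/-- **Two globally minimal curves with the same newform have the same trace of Frobenius at a
good prime**: `a_p(W) = a_p(f) = a_p(W₀)` (`IsNewformOf`: `a_n(f) = a_n(W)`; at a good prime the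
`p`-th Dirichlet coefficient of `L(W, s)` is `p + 1 - #W̃(𝔽_p)`,
`LFunction_apply_prime_eq_frobeniusTrace`). In particular ordinary / supersingular reduction at a
good `p` is a property of the isogeny class. [cite: SilvermanAEC2009, Exercise 8.19(a) (p. 230)] -/
theorem frobeniusTrace_eq_of_isNewformOf_of_isNewformOf [W.IsGloballyMinimal]
    [W₀.IsGloballyMinimal] {p : ℕ} [Fact p.Prime] (hf : IsNewformOf W f)
    (hf₀ : IsNewformOf W₀ f) (hgood : W.HasGoodReductionAtPrime p)
    (hgood₀ : W₀.HasGoodReductionAtPrime p) : W.frobeniusTrace p = W₀.frobeniusTrace p := by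
  have h : ((W.LFunction p : ℤ) : ℂ) = ((W₀.LFunction p : ℤ) : ℂ) := by rw [← hf.2 p, hf₀.2 p]
  have h' : W.LFunction p = W₀.LFunction p := by exact_mod_cast h
  rw [← W.LFunction_apply_prime_eq_frobeniusTrace p hgood,
    ← W₀.LFunction_apply_prime_eq_frobeniusTrace p hgood₀, h']

/-- **`E[p]` irreducible is a property of the `ℚ`-isogeny class** (the contrapositive of
`Rank1Residual.not_hasIrreducibleModPGaloisRep_of_isIsogenous`, with the symmetry of isogeny in
characteristic `0`). This is the form used by Greenberg–Vatsal 2000, §3, Rem. 3.4 ("if `E` does not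
admit any `p`-isogenies, so that `E[p]` is irreducible, … any isogenous curve").
[cite: GreenbergVatsal2000, §3, Remark 3.4] -/
theorem hasIrreducibleModPGaloisRep_of_isIsogenous {p : ℕ} [Fact p.Prime]
    (h : W.IsIsogenous W₀) (hirr : W.HasIrreducibleModPGaloisRep p) :
    W₀.HasIrreducibleModPGaloisRep p := by
  by_contra hred
  exact Rank1Residual.not_hasIrreducibleModPGaloisRep_of_isIsogenous
    (IsIsogenous.symm_of_charZero h) hred hirr

end Transport

/-! ### §2. The assembly at any prime, with the Manin hypothesis asked only of the strong Weil curve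
isogenous to `W` -/

section Assembly

open SkinnerUrban2014

variable {N : ℕ} [NeZero N]

/-- For an integer `z` not divisible by the prime `p`, `‖z‖_p = 1` (private helper). [folklore] -/
private theorem padicNorm_intCast_eq_one_of_not_dvd {p : ℕ} [Fact p.Prime] {z : ℤ}
    (h : ¬ (p : ℤ) ∣ z) : ‖(z : ℚ_[p])‖ = 1 :=
  le_antisymm (Padic.norm_int_le_one z)
    (not_lt.mp fun hlt ↦ h (Padic.norm_intCast_lt_one_iff.mp hlt))

/-- **Greenberg–Vatsal 2000, §3, Rem. 3.4 at every prime `p`, modulo the Manin constant of THE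
strong Weil curve of the class** — a sharpening of
`SkinnerUrban2014.exists_unit_mul_plusPeriod_of_irreducible_anyPrime`: the hypothesis `hc` (`p ∤ c₀`)
is asked only of globally minimal `W₀` that are `ℚ`-ISOGENOUS to `W` and carry a lattice-optimal
datum `D₀` (`Λ_{W₀} = c₀ Λ_f`) with the newform `f` of `W` — exactly what Edixhoven's Prop. 2 gives
(`ModularParametrizationData.exists_optimalDatum_of_edixhoven`, discharged by
`edixhoven_int_of_neronLattice_eq_smul_periodLattice_holds`) — so that properties of `W` invariant
under isogeny (good reduction at `p`, `a_p`, irreducibility of `E[p]`) may be fed to the Manin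
input. Conclusion: for `W` globally minimal with `E[p]` irreducible and newform `f`,
`Ω(W) = u · Ω⁺_f`, `u = a|c₀|/q ∈ ℚ`, `‖u‖_p = 1` (`q ∣ d`, `ab = d` for an isogeny `W → W₀` of
degree `d` prime to `p`, `exists_isogeny_not_dvd_degree_of_irreducible`,
`exists_int_mul_realPeriodRat_eq_of_isogeny`; `Ω(W₀) = |c₀| Ω⁺_f`,
`realPeriodRat_eq_abs_mul_plusPeriod_of_latticeEq`). [cite: GreenbergVatsal2000, §3, Remark 3.4]
[cite: EdixhovenManin1991, Prop. 2 and §1] -/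
theorem exists_unit_mul_plusPeriod_of_irreducible_of_optimal (W : WeierstrassCurve ℚ)
    [W.IsElliptic] [W.IsGloballyMinimal] (p : ℕ) [Fact p.Prime]
    (hirr : W.HasIrreducibleModPGaloisRep p) (f : CuspForm (Gamma0 N) 2) (hf : IsNewformOf W f)
    (hc : ∀ (W₀ : WeierstrassCurve ℚ) [W₀.IsElliptic] [W₀.IsGloballyMinimal]
      (D₀ : ModularParametrizationData W₀ N), D₀.f = f → W.IsIsogenous W₀ →
      (∀ z ∈ D₀.L.lattice, ∃ w ∈ periodLattice D₀.f, z = D₀.c * w) → ¬ (p : ℤ) ∣ D₀.maninConstant) :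
    ∃ u : ℚ, ‖(u : ℚ_[p])‖ = 1 ∧ W.realPeriodRat = u * plusPeriod f := by
  have hpP : p.Prime := Fact.out
  -- a datum of `W` at level `N`, with newform `f`
  obtain ⟨D⟩ := Literature.NumberTheory.Automorphic.nonempty_modularParametrizationData_of_isNewformOf hf
  have hDf : D.f = f := D.isNewformOf.unique hf
  subst hDf
  -- the optimal datum on a globally minimal model of the strong Weil curve, isogenous to `W`
  obtain ⟨W₀, hW₀, hW₀', D₀, hf₀, hiso, hopt, -⟩ :=
    D.exists_optimalDatum_of_edixhoven
      (fun hf' hL' q hq hq' ↦ edixhoven_int_of_neronLattice_eq_smul_periodLattice_holds hf' hL' q hq hq')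
  have hc₀ : ¬ (p : ℤ) ∣ D₀.c := hc W₀ D₀ hf₀ hiso hopt
  -- an isogeny `W → W₀` of degree prime to `p`
  obtain ⟨ψ, hψ⟩ := exists_isogeny_not_dvd_degree_of_irreducible (W := W) (W' := W₀)
    (Nat.cast_ne_zero.mpr hpP.ne_zero) hirr hiso
  -- the lattice step (full periods) and the optimal-curve step (exact)
  obtain ⟨q, a, b, hq0, hqd, hab, hqa⟩ := exists_int_mul_realPeriodRat_eq_of_isogeny D D₀ ψ
  have hm := D₀.realPeriodRat_eq_abs_mul_plusPeriod_of_latticeEq hopt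
  rw [hf₀] at hm
  have hq0' : (q : ℝ) ≠ 0 := by exact_mod_cast hq0
  -- not divisible by `p`
  have hpa : ¬ (p : ℤ) ∣ a := fun h ↦ hψ (Int.natCast_dvd_natCast.mp (hab ▸ h.mul_right b))
  have hpq : ¬ (p : ℤ) ∣ q := fun h ↦ hψ (Int.natCast_dvd_natCast.mp (h.trans hqd))
  have hpc : ¬ (p : ℤ) ∣ |D₀.c| := fun h ↦ hc₀ ((dvd_abs _ _).mp h)
  refine ⟨((a : ℚ) * (|D₀.c| : ℤ)) / (q : ℚ), ?_, ?_⟩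
  · have e : ((((a : ℚ) * (|D₀.c| : ℤ)) / (q : ℚ) : ℚ) : ℚ_[p]) =
        ((a : ℚ_[p]) * ((|D₀.c| : ℤ) : ℚ_[p])) / (q : ℚ_[p]) := by
      simp only [Rat.cast_div, Rat.cast_mul, Rat.cast_intCast]
    rw [e, norm_div, norm_mul, padicNorm_intCast_eq_one_of_not_dvd hpa,
      padicNorm_intCast_eq_one_of_not_dvd hpc, padicNorm_intCast_eq_one_of_not_dvd hpq]
    norm_num
  · -- `Ω(W) = (a/q) Ω(W₀) = a |c₀| Ω⁺_f / q`
    rw [← Int.cast_abs] at hm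
    have h1 : W.realPeriodRat * (q : ℝ) = ((a : ℝ) * ((|D₀.c| : ℤ) : ℝ)) * plusPeriod D.f := by
      calc W.realPeriodRat * (q : ℝ) = (q : ℝ) * W.realPeriodRat := mul_comm _ _
        _ = a * W₀.realPeriodRat := hqa
        _ = ((a : ℝ) * ((|D₀.c| : ℤ) : ℝ)) * plusPeriod D.f := by rw [hm]; ring
    have hcast : ((((a : ℚ) * (|D₀.c| : ℤ)) / (q : ℚ) : ℚ) : ℝ) =
        ((a : ℝ) * ((|D₀.c| : ℤ) : ℝ)) / (q : ℝ) := by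
      simp only [Rat.cast_div, Rat.cast_mul, Rat.cast_intCast]
    rw [hcast, div_mul_eq_mul_div, eq_div_iff hq0']
    exact h1

end Assembly

/-! ### §3. The fact is EQUIVALENT to the parity of the Manin constant on its slice -/

section Equivalence

/-- **`realPeriodRat_eq_unit_mul_plusPeriod_two` from the Manin constant at `2` of the
`E[2]`-irreducible strong Weil curves with good reduction at `2`** (the (M₂-irr) direction ⇐).
Displayed hypothesis `hM` (the `E[2]`-irreducible slice at `p = 2 ∤ N` of Abbes–Ullmo 1996 Thm. A,
in the lattice rendering of `abbesUllmo_not_dvd_maninConstant_of_not_dvd_level`): for every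
globally minimal elliptic `W₀/ℚ` with good reduction at `2` and `E₀[2]` irreducible and every datum
`D₀` at any level with `Λ_{W₀} ⊆ c₀ Λ_f` (so `Λ_{W₀} = c₀ Λ_f`), `2 ∤ c₀`. Proof: the assembly
`exists_unit_mul_plusPeriod_of_irreducible_of_optimal` at `p = 2`; the strong Weil curve `W₀`
isogenous to `W` has good reduction at `2` (same newform, `2 ∤ N`) and `E₀[2]` irreducible
(`hasIrreducibleModPGaloisRep_of_isIsogenous`). [cite: AbbesUllmo1996, Thm. A]
[cite: GreenbergVatsal2000, §3, Remark 3.4] [cite: EdixhovenManin1991, Prop. 2 and §1] -/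
theorem realPeriodRat_eq_unit_mul_plusPeriod_two_of_maninConstant_odd_of_irreducible
    (hM : ∀ (W₀ : WeierstrassCurve ℚ) [W₀.IsElliptic] [W₀.IsGloballyMinimal],
      W₀.HasGoodReductionAtPrime 2 → W₀.HasIrreducibleModPGaloisRep 2 →
      ∀ {N₀ : ℕ} [NeZero N₀] (D₀ : ModularParametrizationData W₀ N₀),
      (∀ z ∈ D₀.L.lattice, ∃ w ∈ periodLattice D₀.f, z = D₀.c * w) →
      ¬ (2 : ℤ) ∣ D₀.maninConstant) :
    realPeriodRat_eq_unit_mul_plusPeriod_two := by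
  intro W _ _ hgood hirr N _ f hf
  refine exists_unit_mul_plusPeriod_of_irreducible_of_optimal W 2 hirr f hf
    fun W₀ _ _ D₀ hf₀ hiso hopt ↦ ?_
  have hf₀' : IsNewformOf W₀ f := hf₀ ▸ D₀.isNewformOf
  exact_mod_cast hM W₀ (hasGoodReductionAtPrime_of_isNewformOf_of_isNewformOf hf hf₀' hgood)
    (hasIrreducibleModPGaloisRep_of_isIsogenous hiso hirr) D₀ hopt

/-- **Conversely, the fact FORCES the Manin constant at `2` to be odd on its slice** (direction ⇒):
granted `realPeriodRat_eq_unit_mul_plusPeriod_two`, for every globally minimal elliptic `W₀/ℚ` with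
good reduction at `2` and `E₀[2]` irreducible and every lattice-optimal datum `D₀` (`Λ_{W₀} = c₀ Λ_f`),
`2 ∤ c₀`. Indeed the fact at `W₀` with the newform `f = D₀.f` gives `Ω(W₀) = u · Ω⁺_f`, `‖u‖₂ = 1`,
while `Ω(W₀) = |c₀| · Ω⁺_f` EXACTLY for a lattice-optimal datum
(`ModularParametrizationData.realPeriodRat_eq_abs_mul_plusPeriod_of_latticeEq`, Edixhoven 1991 §1)
and `Ω⁺_f > 0` (`IsNewform0.plusPeriod_pos_holds`); so `u = |c₀|` and `‖c₀‖₂ = 1`. Hence the fact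
is not weaker than the parity statement: its content IS the `E[2]`-irreducible slice at `p = 2 ∤ N`
of Abbes–Ullmo's Thm. A. [cite: AbbesUllmo1996, Thm. A] [cite: EdixhovenManin1991, Prop. 2 and §1] -/
theorem not_two_dvd_maninConstant_of_irreducible_of_realPeriodRat_eq_unit_mul_plusPeriod_two
    (h : realPeriodRat_eq_unit_mul_plusPeriod_two) (W₀ : WeierstrassCurve ℚ) [W₀.IsElliptic]
    [W₀.IsGloballyMinimal] (hgood : W₀.HasGoodReductionAtPrime 2)
    (hirr : W₀.HasIrreducibleModPGaloisRep 2) {N₀ : ℕ} [NeZero N₀]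
    (D₀ : ModularParametrizationData W₀ N₀)
    (hopt : ∀ z ∈ D₀.L.lattice, ∃ w ∈ periodLattice D₀.f, z = D₀.c * w) :
    ¬ (2 : ℤ) ∣ D₀.maninConstant := by
  intro hdvd
  obtain ⟨u, hu, hΩ⟩ := h W₀ hgood hirr D₀.f D₀.isNewformOf
  have hexact := D₀.realPeriodRat_eq_abs_mul_plusPeriod_of_latticeEq hopt
  have hplus : 0 < plusPeriod D₀.f :=
    IsNewform0.plusPeriod_pos_holds D₀.isNewformOf.1 D₀.isNewformOf.coeffField_eq_bot
  -- `u = |c₀|` as real numbers, hence as rationals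
  have huR : (u : ℝ) = |(D₀.c : ℝ)| := by
    have h1 : (u : ℝ) * plusPeriod D₀.f = |(D₀.c : ℝ)| * plusPeriod D₀.f := by rw [← hΩ, hexact]
    exact mul_right_cancel₀ hplus.ne' h1
  have huQ : u = ((|D₀.c| : ℤ) : ℚ) := by
    have h2 : ((u : ℚ) : ℝ) = ((((|D₀.c| : ℤ) : ℚ)) : ℝ) := by
      rw [huR, Rat.cast_intCast, Int.cast_abs]
    exact_mod_cast h2
  -- but `2 ∣ c₀` makes `‖c₀‖₂ < 1`
  have hlt : ‖(((|D₀.c| : ℤ) : ℚ) : ℚ_[2])‖ < 1 := by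
    rw [Rat.cast_intCast]
    exact Padic.norm_intCast_lt_one_iff.mpr ((dvd_abs _ _).mpr hdvd)
  rw [← huQ, hu] at hlt
  exact lt_irrefl _ hlt

/-- **`realPeriodRat_eq_unit_mul_plusPeriod_two` ⟺ (M₂-irr)**: the named fact is EQUIVALENT, over
the tree, to the parity of the Manin constant of every lattice-optimal datum of a globally minimal
curve with good reduction at `2` and irreducible `E[2]` — the `E[2]`-irreducible slice at
`p = 2 ∤ N` of Abbes–Ullmo 1996, Thm. A (whose full lattice rendering is the tree's named fact
`abbesUllmo_not_dvd_maninConstant_of_not_dvd_level`; the slice follows from it,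
`maninConstant_odd_of_irreducible_of_abbesUllmo`). [cite: AbbesUllmo1996, Thm. A]
[cite: GreenbergVatsal2000, §3, Remark 3.4] [cite: EdixhovenManin1991, Prop. 2 and §1] -/
theorem realPeriodRat_eq_unit_mul_plusPeriod_two_iff_maninConstant_odd :
    realPeriodRat_eq_unit_mul_plusPeriod_two ↔
      ∀ (W₀ : WeierstrassCurve ℚ) [W₀.IsElliptic] [W₀.IsGloballyMinimal],
        W₀.HasGoodReductionAtPrime 2 → W₀.HasIrreducibleModPGaloisRep 2 →
        ∀ {N₀ : ℕ} [NeZero N₀] (D₀ : ModularParametrizationData W₀ N₀),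
        (∀ z ∈ D₀.L.lattice, ∃ w ∈ periodLattice D₀.f, z = D₀.c * w) →
        ¬ (2 : ℤ) ∣ D₀.maninConstant :=
  ⟨fun h W₀ _ _ hgood hirr _ _ D₀ hopt ↦
      not_two_dvd_maninConstant_of_irreducible_of_realPeriodRat_eq_unit_mul_plusPeriod_two h W₀
        hgood hirr D₀ hopt,
    realPeriodRat_eq_unit_mul_plusPeriod_two_of_maninConstant_odd_of_irreducible⟩

/-- **(M₂-irr) in LEVEL form ⟺ in REDUCTION form.** The slice may be indexed by the level of the
datum (`2 ∤ N₀`, as in `abbesUllmo_not_dvd_maninConstant_of_not_dvd_level`) or by the reduction of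
the curve (good at `2`, as in the fact): for a curve carrying a datum at level `N₀` these agree
(`hasGoodReductionAtPrime_of_isNewformOf_of_not_dvd_level`,
`SkinnerUrban2014.not_dvd_level_of_hasGoodReductionAtPrime`). [cite: DiamondShurman2005, Thm. 8.8.1] -/
theorem maninConstant_odd_of_irreducible_level_iff_reduction :
    (∀ (W₀ : WeierstrassCurve ℚ) [W₀.IsElliptic] [W₀.IsGloballyMinimal] {N₀ : ℕ} [NeZero N₀]
        (D₀ : ModularParametrizationData W₀ N₀),
        (∀ z ∈ D₀.L.lattice, ∃ w ∈ periodLattice D₀.f, z = D₀.c * w) →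
        ¬ 2 ∣ N₀ → W₀.HasIrreducibleModPGaloisRep 2 → ¬ (2 : ℤ) ∣ D₀.maninConstant) ↔
      ∀ (W₀ : WeierstrassCurve ℚ) [W₀.IsElliptic] [W₀.IsGloballyMinimal],
        W₀.HasGoodReductionAtPrime 2 → W₀.HasIrreducibleModPGaloisRep 2 →
        ∀ {N₀ : ℕ} [NeZero N₀] (D₀ : ModularParametrizationData W₀ N₀),
        (∀ z ∈ D₀.L.lattice, ∃ w ∈ periodLattice D₀.f, z = D₀.c * w) →
        ¬ (2 : ℤ) ∣ D₀.maninConstant :=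
  ⟨fun h W₀ _ _ hgood hirr _ _ D₀ hopt ↦ h W₀ D₀ hopt
      (SkinnerUrban2014.not_dvd_level_of_hasGoodReductionAtPrime hgood D₀.isNewformOf) hirr,
    fun h W₀ _ _ _ _ D₀ hopt h2N hirr ↦
      h W₀ (hasGoodReductionAtPrime_of_isNewformOf_of_not_dvd_level D₀.isNewformOf h2N) hirr D₀
        hopt⟩

/-- **(M₂-irr) is a slice of Abbes–Ullmo's Thm. A** (tree named fact
`abbesUllmo_not_dvd_maninConstant_of_not_dvd_level`, NOT discharged): good reduction at `2` puts the
level prime to `2`. Composed with `realPeriodRat_eq_unit_mul_plusPeriod_two_of_maninConstant_odd_of_irreducible`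
this recovers `SkinnerUrban2014.realPeriodRat_eq_unit_mul_plusPeriod_two_fact_of_abbesUllmo`.
[cite: AbbesUllmo1996, Thm. A] -/
theorem maninConstant_odd_of_irreducible_of_abbesUllmo
    (hAU : abbesUllmo_not_dvd_maninConstant_of_not_dvd_level) (W₀ : WeierstrassCurve ℚ)
    [W₀.IsElliptic] [W₀.IsGloballyMinimal] (hgood : W₀.HasGoodReductionAtPrime 2)
    (_hirr : W₀.HasIrreducibleModPGaloisRep 2) {N₀ : ℕ} [NeZero N₀]
    (D₀ : ModularParametrizationData W₀ N₀)
    (hopt : ∀ z ∈ D₀.L.lattice, ∃ w ∈ periodLattice D₀.f, z = D₀.c * w) :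
    ¬ (2 : ℤ) ∣ D₀.maninConstant := by
  exact_mod_cast hAU W₀ D₀ hopt 2 Nat.prime_two
    (SkinnerUrban2014.not_dvd_level_of_hasGoodReductionAtPrime hgood D₀.isNewformOf)

end Equivalence

/-! ### §4. The two printed roads, as reductions at `p = 2` -/

section Roads

/-- **Road (a): Abbes–Ullmo's own proof, at `p = 2` only.** The fact follows from
(`hR`) Ribet's `deg φ ∣ r` for the optimal data concerned ([AU96, Lemme 3.2 (iii)]; an instance of
the tree's named fact `modularDegree_dvd_congruenceNumber`, since a lattice-optimal datum has
minimal degree, `modularDegree_le_of_isogenyMap_ker_eq_bot`) and (`hX`) the degree relation of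
[AU96, Prop. 3.3 with Prop. 3.4] AT `p = 2 ∤ N` for the `E[2]`-irreducible optimal data of globally
minimal curves with good reduction at `2`: `r = congruenceNumber D₀.f ≠ 0` and
`v₂(r) + v₂(c₀) ≤ v₂(deg φ_{D₀})` — then `v₂(c₀) ≤ v₂(deg φ) - v₂(r) ≤ 0` (p. 279;
`ModularParametrizationData.not_dvd_maninConstant_of_dvd_congruenceNumber_of_le`). This is the
`p = 2`, `E[2]`-irreducible slice of the AU seat's reduction
`abbesUllmo_not_dvd_maninConstant_of_not_dvd_level_of_ribet_of_degreeRelation`; `hX` is displayed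
because its printed proof needs the Néron models of `E₀`, `J₀(N)` over `ℤ_(2)` and `M₀(N)_{ℤ_(2)}`.
[cite: AbbesUllmo1996, Lemme 3.2 (iii), Prop. 3.3, Prop. 3.4, Preuve du Thm. A (pp. 276–279)]
[cite: AgasheRibetStein2012, Thm. 2.1] -/
theorem realPeriodRat_eq_unit_mul_plusPeriod_two_of_ribet_of_degreeRelation_two
    (hR : ∀ (W₀ : WeierstrassCurve ℚ) [W₀.IsElliptic] [W₀.IsGloballyMinimal] {N₀ : ℕ} [NeZero N₀]
      (D₀ : ModularParametrizationData W₀ N₀),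
      (∀ z ∈ D₀.L.lattice, ∃ w ∈ periodLattice D₀.f, z = D₀.c * w) →
      D₀.modularDegree ∣ congruenceNumber D₀.f)
    (hX : ∀ (W₀ : WeierstrassCurve ℚ) [W₀.IsElliptic] [W₀.IsGloballyMinimal],
      W₀.HasGoodReductionAtPrime 2 → W₀.HasIrreducibleModPGaloisRep 2 →
      ∀ {N₀ : ℕ} [NeZero N₀] (D₀ : ModularParametrizationData W₀ N₀),
      (∀ z ∈ D₀.L.lattice, ∃ w ∈ periodLattice D₀.f, z = D₀.c * w) →
      congruenceNumber D₀.f ≠ 0 ∧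
        padicValNat 2 (congruenceNumber D₀.f) + padicValInt 2 D₀.maninConstant ≤
          padicValNat 2 D₀.modularDegree) :
    realPeriodRat_eq_unit_mul_plusPeriod_two := by
  refine realPeriodRat_eq_unit_mul_plusPeriod_two_of_maninConstant_odd_of_irreducible
    fun W₀ _ _ hgood hirr N₀ _ D₀ hopt ↦ ?_
  obtain ⟨hr, hle⟩ := hX W₀ hgood hirr D₀ hopt
  exact_mod_cast D₀.not_dvd_maninConstant_of_dvd_congruenceNumber_of_le (hR W₀ D₀ hopt) hr
    Nat.prime_two hle

/-- Ribet's divisibility `deg φ ∣ r` for lattice-optimal data is an instance of the tree's named fact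
`modularDegree_dvd_congruenceNumber` (stated for data of minimal degree; a lattice-optimal datum has
minimal degree, `ModularParametrizationData.modularDegree_le_of_isogenyMap_ker_eq_bot`), so road
(a) displays, beyond the tree's facts, only the degree relation `hX`.
[cite: AgasheRibetStein2012, Thm. 2.1] [cite: AbbesUllmo1996, Lemme 3.2 (iii)] -/
theorem modularDegree_dvd_congruenceNumber_of_optimal (hR : modularDegree_dvd_congruenceNumber)
    (W₀ : WeierstrassCurve ℚ) [W₀.IsElliptic] {N₀ : ℕ} [NeZero N₀]
    (D₀ : ModularParametrizationData W₀ N₀)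
    (hopt : ∀ z ∈ D₀.L.lattice, ∃ w ∈ periodLattice D₀.f, z = D₀.c * w) :
    D₀.modularDegree ∣ congruenceNumber D₀.f :=
  hR W₀ N₀ D₀ fun _ _ D'' hf ↦
    D₀.modularDegree_le_of_isogenyMap_ker_eq_bot (D₀.isogenyMap_ker_eq_bot_iff.mpr hopt) D'' hf

/-- **Road (b): the Mazur–Raynaud road on the supersingular habitat.** For a globally minimal
elliptic `W/ℚ` with good SUPERSINGULAR reduction at `2` (`2 ∣ a₂(W)`), `E[2]` irreducible, and its
newform `f`: `Ω(W) = u · Ω⁺_f` with `‖u‖₂ = 1`, GRANTED the displayed hypothesis `hMR` — *the Manin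
constant of a lattice-optimal datum of a globally minimal curve with good supersingular reduction at
`2` is odd* — which is what Raynaud's letter proves (Abbes–Ullmo 1996, Prop. 3.1 with its proof,
pp. 274–275, case `r = 0`: `0 → Lie A → Lie J₀(N) → Lie E → 0` exact over `ℤ₂` forces
`v₂(c_E) = 0` by the `q`-expansion principle on `M₀(N)_{𝔽₂}`; and `r = 0`, i.e. `Lie J₀(N) → Lie E`
onto, holds when `E^μ = 0`, Appendice Cor. A.3 (ii), in particular for `E` supersingular at `2` —
equivalently Cor. A.4: the only possible exceptions at a good prime `2` are ordinary curves with
`E[2] ≅` étale × multiplicative). The Manin input is fed to the strong Weil curve `W₀` isogenous to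
`W` (`exists_unit_mul_plusPeriod_of_irreducible_of_optimal`), which is again good supersingular at
`2`: `a₂(W₀) = a₂(f) = a₂(W)` (`frobeniusTrace_eq_of_isNewformOf_of_isNewformOf`). On this habitat
`E[2]` is automatically irreducible (no `2`-torsion in a height-`2` formal group over `ℤ₂`, and
`#W̃(𝔽₂)` odd); the hypothesis `hirr` is kept as in the fact. Not formalised: Néron models,
`p`-divisible groups (Tate's theorem), `M₀(N)_{ℤ₂}`.
[cite: AbbesUllmo1996, Prop. 3.1 (pp. 274–275), Cor. A.3 (ii) and Cor. A.4 (p. 285), p. 270]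
[cite: GreenbergVatsal2000, §3, Remark 3.4] -/
theorem exists_unit_mul_plusPeriod_two_of_goodSupersingular_of_maninConstant_odd
    (hMR : ∀ (W₀ : WeierstrassCurve ℚ) [W₀.IsElliptic] [W₀.IsGloballyMinimal],
      W₀.HasGoodReductionAtPrime 2 → (2 : ℤ) ∣ W₀.frobeniusTrace 2 →
      ∀ {N₀ : ℕ} [NeZero N₀] (D₀ : ModularParametrizationData W₀ N₀),
      (∀ z ∈ D₀.L.lattice, ∃ w ∈ periodLattice D₀.f, z = D₀.c * w) →
      ¬ (2 : ℤ) ∣ D₀.maninConstant)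
    (W : WeierstrassCurve ℚ) [W.IsElliptic] [W.IsGloballyMinimal]
    (hgood : W.HasGoodReductionAtPrime 2) (hss : (2 : ℤ) ∣ W.frobeniusTrace 2)
    (hirr : W.HasIrreducibleModPGaloisRep 2) {N : ℕ} [NeZero N] (f : CuspForm (Gamma0 N) 2)
    (hf : IsNewformOf W f) :
    ∃ u : ℚ, ‖(u : ℚ_[2])‖ = 1 ∧ W.realPeriodRat = u * plusPeriod f := by
  refine exists_unit_mul_plusPeriod_of_irreducible_of_optimal W 2 hirr f hf
    fun W₀ _ _ D₀ hf₀ _ hopt ↦ ?_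
  have hf₀' : IsNewformOf W₀ f := hf₀ ▸ D₀.isNewformOf
  have hgood₀ : W₀.HasGoodReductionAtPrime 2 :=
    hasGoodReductionAtPrime_of_isNewformOf_of_isNewformOf hf hf₀' hgood
  have hss₀ : (2 : ℤ) ∣ W₀.frobeniusTrace 2 := by
    rwa [← frobeniusTrace_eq_of_isNewformOf_of_isNewformOf hf hf₀' hgood hgood₀]
  exact_mod_cast hMR W₀ hgood₀ hss₀ D₀ hopt

/-- **On the good-supersingular habitat the period-unit statement is again EXACTLY the parity of the
Manin constant** (the habitat analogue of `realPeriodRat_eq_unit_mul_plusPeriod_two_iff_maninConstant_odd`,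
with the irreducibility of `E[2]` carried on both sides as in the fact): "for every globally minimal
elliptic `W` with good supersingular reduction at `2`, `E[2]` irreducible and newform `f`,
`Ω(W) = u · Ω⁺_f` with `‖u‖₂ = 1`" ⟺ "for every such `W₀` and every lattice-optimal datum `D₀` of
`W₀`, `2 ∤ c₀`" — ⇐ is `exists_unit_mul_plusPeriod_two_of_goodSupersingular_of_maninConstant_odd`
(with the extra irreducibility input simply transported, `hasIrreducibleModPGaloisRep_of_isIsogenous`),
⇒ evaluates at `W₀` (`Ω(W₀) = |c₀| · Ω⁺_f`). So the binder a consumer on this habitat displays is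
precisely Raynaud's statement (Abbes–Ullmo 1996, Prop. 3.1 + Cor. A.3 (ii)) on `E[2]`-irreducible
curves. [cite: AbbesUllmo1996, Prop. 3.1 (pp. 274–275) and Cor. A.3 (ii) (p. 285)]
[cite: EdixhovenManin1991, Prop. 2 and §1] -/
theorem exists_unit_mul_plusPeriod_two_of_goodSupersingular_iff_maninConstant_odd :
    (∀ (W : WeierstrassCurve ℚ) [W.IsElliptic] [W.IsGloballyMinimal],
        W.HasGoodReductionAtPrime 2 → (2 : ℤ) ∣ W.frobeniusTrace 2 →
        W.HasIrreducibleModPGaloisRep 2 →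
        ∀ {N : ℕ} [NeZero N] (f : CuspForm (Gamma0 N) 2), IsNewformOf W f →
        ∃ u : ℚ, ‖(u : ℚ_[2])‖ = 1 ∧ W.realPeriodRat = u * plusPeriod f) ↔
      ∀ (W₀ : WeierstrassCurve ℚ) [W₀.IsElliptic] [W₀.IsGloballyMinimal],
        W₀.HasGoodReductionAtPrime 2 → (2 : ℤ) ∣ W₀.frobeniusTrace 2 →
        W₀.HasIrreducibleModPGaloisRep 2 →
        ∀ {N₀ : ℕ} [NeZero N₀] (D₀ : ModularParametrizationData W₀ N₀),
        (∀ z ∈ D₀.L.lattice, ∃ w ∈ periodLattice D₀.f, z = D₀.c * w) →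
        ¬ (2 : ℤ) ∣ D₀.maninConstant := by
  constructor
  · intro h W₀ _ _ hgood hss hirr N₀ _ D₀ hopt hdvd
    obtain ⟨u, hu, hΩ⟩ := h W₀ hgood hss hirr D₀.f D₀.isNewformOf
    have hexact := D₀.realPeriodRat_eq_abs_mul_plusPeriod_of_latticeEq hopt
    have hplus : 0 < plusPeriod D₀.f :=
      IsNewform0.plusPeriod_pos_holds D₀.isNewformOf.1 D₀.isNewformOf.coeffField_eq_bot
    have huR : (u : ℝ) = |(D₀.c : ℝ)| := by
      have h1 : (u : ℝ) * plusPeriod D₀.f = |(D₀.c : ℝ)| * plusPeriod D₀.f := by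
        rw [← hΩ, hexact]
      exact mul_right_cancel₀ hplus.ne' h1
    have huQ : u = ((|D₀.c| : ℤ) : ℚ) := by
      have h2 : ((u : ℚ) : ℝ) = ((((|D₀.c| : ℤ) : ℚ)) : ℝ) := by
        rw [huR, Rat.cast_intCast, Int.cast_abs]
      exact_mod_cast h2
    have hlt : ‖(((|D₀.c| : ℤ) : ℚ) : ℚ_[2])‖ < 1 := by
      rw [Rat.cast_intCast]
      exact Padic.norm_intCast_lt_one_iff.mpr ((dvd_abs _ _).mpr hdvd)
    rw [← huQ, hu] at hlt
    exact lt_irrefl _ hlt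
  · intro h W _ _ hgood hss hirr N _ f hf
    refine exists_unit_mul_plusPeriod_of_irreducible_of_optimal W 2 hirr f hf
      fun W₀ _ _ D₀ hf₀ hiso hopt ↦ ?_
    have hf₀' : IsNewformOf W₀ f := hf₀ ▸ D₀.isNewformOf
    have hgood₀ : W₀.HasGoodReductionAtPrime 2 :=
      hasGoodReductionAtPrime_of_isNewformOf_of_isNewformOf hf hf₀' hgood
    have hss₀ : (2 : ℤ) ∣ W₀.frobeniusTrace 2 := by
      rwa [← frobeniusTrace_eq_of_isNewformOf_of_isNewformOf hf hf₀' hgood hgood₀]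
    exact_mod_cast h W₀ hgood₀ hss₀ (hasIrreducibleModPGaloisRep_of_isIsogenous hiso hirr) D₀ hopt

/-- **The supersingular road's input is implied by (M₂-irr)'s source too**: Abbes–Ullmo's Thm. A
(tree named fact) gives `hMR` outright (no use of supersingularity), so road (b) displays nothing
beyond print. [cite: AbbesUllmo1996, Thm. A] -/
theorem maninConstant_odd_of_goodSupersingular_of_abbesUllmo
    (hAU : abbesUllmo_not_dvd_maninConstant_of_not_dvd_level) (W₀ : WeierstrassCurve ℚ)
    [W₀.IsElliptic] [W₀.IsGloballyMinimal] (hgood : W₀.HasGoodReductionAtPrime 2)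
    (_hss : (2 : ℤ) ∣ W₀.frobeniusTrace 2) {N₀ : ℕ} [NeZero N₀]
    (D₀ : ModularParametrizationData W₀ N₀)
    (hopt : ∀ z ∈ D₀.L.lattice, ∃ w ∈ periodLattice D₀.f, z = D₀.c * w) :
    ¬ (2 : ℤ) ∣ D₀.maninConstant := by
  exact_mod_cast hAU W₀ D₀ hopt 2 Nat.prime_two
    (SkinnerUrban2014.not_dvd_level_of_hasGoodReductionAtPrime hgood D₀.isNewformOf)

end Roads

/-! ### §5. What computation settles: levels `N ≤ 130000` (Cremona) -/

section Cremona

/-- **The conclusion of the fact for newforms of level `N ≤ 130000`, from Cremona's verification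
`c = 1`** (Agashe–Ribet–Stein 2006, Thm. 2.6; tree named fact
`AgasheRibetStein2006.cremona_abs_maninConstant_eq_one_of_level_le`, NOT discharged — a finite
computation outside the kernel): for a globally minimal elliptic `W/ℚ` with `E[2]` irreducible and
newform `f` of level `N ≤ 130000`, `Ω(W) = u · Ω⁺_f`, `‖u‖₂ = 1` (no reduction hypothesis at `2`
is needed on this range). A finite range of levels, not the fact.
[cite: AgasheRibetStein2006, Thm. 2.6] [cite: GreenbergVatsal2000, §3, Remark 3.4] -/
theorem exists_unit_mul_plusPeriod_two_of_level_le_of_cremona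
    (hC : AgasheRibetStein2006.cremona_abs_maninConstant_eq_one_of_level_le)
    (W : WeierstrassCurve ℚ) [W.IsElliptic] [W.IsGloballyMinimal]
    (hirr : W.HasIrreducibleModPGaloisRep 2) {N : ℕ} [NeZero N] (hN : N ≤ 130000)
    (f : CuspForm (Gamma0 N) 2) (hf : IsNewformOf W f) :
    ∃ u : ℚ, ‖(u : ℚ_[2])‖ = 1 ∧ W.realPeriodRat = u * plusPeriod f :=
  exists_unit_mul_plusPeriod_of_irreducible_of_optimal W 2 hirr f hf
    fun W₀ _ _ D₀ _ _ hopt ↦ by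
      exact_mod_cast abbesUllmo_not_dvd_maninConstant_of_level_le_of_cremona hC W₀ D₀ hopt hN
        Nat.prime_two

end Cremona

end Literature.NumberTheory.EllipticCurves

end
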